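import Summits.ResolutionOfSingularities.ResolutionOfSingularities.Theorems.MaxContactCutTauChainCut
import Summits.ResolutionOfSingularities.ResolutionOfSingularities.Theorems.MaxContactCutSatelliteCut
import Summits.ResolutionOfSingularities.ResolutionOfSingularities.Theorems.MaxContactCutWallCutCells
import Summits.ResolutionOfSingularities.ResolutionOfSingularities.Theorems.FactorCutCells2
import HarnessLib

/-!
# MaxContactCutFactorCut — decomp-res node «FactorCut» (lens-4 g33, critic row 191 CLEARED +1), tree file 5/5 of the node

Content VERBATIM from the decomp-res lens-4 g33 node `HOME/decomp-res-lens-4/g33/FactorCut.lean` (pin dd0f861c; NEW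
part §99–§104 only; the node's carry of g32 rev 2 dropped in favour of `import …TauChainCutCells2`); HOME =
run/shared/lean/pub/decomp-res; critic row 191 CLEARED +1; landing orders INBOX :1049/:1051 — provenance, critic
text and the lens header in full in the first file of the node, `FactorCutKernels`.  Namespace
`…Theorems.HugValuationCut`; `--supports stmt-ResolutionOfSingularities-28338`.

## This file

THE §103 COROLLARIES GIVEN 31571 `MaxContactCut.NoContactHuggingTowers` BY NAME (in the Theses cone):
`noWildLatentFactorNonThreefoldMixedTowers_of_h71` ·
`noWildMixedWallFreeFreshJumpShallowCompanionKangarooTowers_iff_g33_of_h71` ·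
`noWildNonSurfaceWallFreeFreshJumpShallowCompanionKangarooTowers_iff_g33` ·
`noWildContactFreeOffLocusTowers_iff_g33` · `noWildPPowerOffLocusTowers_iff_g33` — cell B EMPTY modulo 31571, TREE
ASIDE 28338 / the g23–g32 residuals ⟺ the g33 located OCCULT residual (cells C ∧ D) MODULO the port
`SurfaceChainPort`, through `MaxContactCutTauChainCut`'s `…_iff_g32 (h71) (h640)` family and the hypothesis-free
`noWildMixedWallFreeFreshJumpShallowCompanionKangarooTowers_iff_g33`.  Imports `MaxContactCutTauChainCut` +
`FactorCutCells2` + the lens's three cone imports; 0 sorry.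

[WRITER NOTE (decomp-res writer g12): file split only (tree files ≤ 400 lines); namespace, sections, section
variables / universes / opens and every declaration exactly as in the lens (the carry block and the node's global
dupNamespace-linter line are dropped — the library sets the latter; the two namespace-level `open
…AbsoluteContactClasses` / `open …Hironaka2005 (…)` lines of the new part are replayed in every file; the `open
…Theses` line and the lens's cone imports `MaxContactCutSatelliteCut` / `MaxContactCutWallCutCells` /
`MaxContactCutSurfacePort` live only in the Theses-cone file `MaxContactCutFactorCut`).]

(Sources: Hironaka1964 Ch. III; Giraud1975 (Giraud's lemma); Kollar2007 3.58–3.60; CossartJannsenSaito2020 Thm.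
6.40, Def. 6.38–6.39, Ch. 8; Hauser2010Kangaroo; HauserPerlega2019 §2; CossartPiltant2008 §2; CossartPiltant2019;
Hironaka2005 (three key theorems); EGAIV4 §16; Matsumura1987 §28; StacksProject 0804 / 0BIQ / 031I.)
-/

noncomputable section

open CategoryTheory AlgebraicGeometry IsLocalRing TopologicalSpace
open Literature.AlgebraicGeometry.Resolution
open Summit.ResolutionOfSingularities.ResolutionOfSingularities.Theses
open Summit.ResolutionOfSingularities.ResolutionOfSingularities.Theorems
open WeakOrderReduction ForcedTowerClasses DivergentTowerClasses MonomialTowerClasses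
open HugDimensionClasses HugDimensionKernels SurfaceShadowClasses SurfaceShadowKernels
open NearPointCut (SingularClass)
open Scheme.IdealSheafData (vanishingIdeal)
open scoped BigOperators

namespace Summit.ResolutionOfSingularities.ResolutionOfSingularities.Theorems.HugValuationCut

open Summit.ResolutionOfSingularities.ResolutionOfSingularities.Theorems.AbsoluteContactClasses
  (IsAbsContactAt SepResidueAt AbsInv absInv_point sepResidueAt_of_perfectField)
open Literature.AlgebraicGeometry.Resolution.Hironaka2005 (le_idealOrder_of_mul_le le_idealOrder_of_mul_le')

section FactorCells

variable {k : Type} [Field k]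

/-- **CELL B DECIDED BY NAME MOD 31571.** [folklore] -/
theorem noWildLatentFactorNonThreefoldMixedTowers_of_h71 (h71 : MaxContactCut.NoContactHuggingTowers) :
    NoWildLatentFactorNonThreefoldMixedTowers := fun n hn =>
  wildLatentFactorNonThreefoldMixed_of_contact (h71 n hn)

/-- **EXACT RE-LOCATION BY NAME MOD 31571: the g32 residual ⟺ THE OCCULT CELLS C ∧ D.** [folklore] -/
theorem noWildMixedWallFreeFreshJumpShallowCompanionKangarooTowers_iff_g33_of_h71 (h71 : MaxContactCut.NoContactHuggingTowers) :
    NoWildMixedWallFreeFreshJumpShallowCompanionKangarooTowers ↔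
      NoWildOccultDivisorialMixedTowers ∧ NoWildOccultNonDivisorialMixedTowers :=
  noWildMixedWallFreeFreshJumpShallowCompanionKangarooTowers_iff_g33.trans
    ⟨fun h => h.2, fun h => ⟨noWildLatentFactorNonThreefoldMixedTowers_of_h71 h71, h⟩⟩

/-- **GIVEN THE PORT AND 31571 (hypotheses of the g32 chain): THE TARGET (g31 residual) ⟺ the occult cells.** [folklore] -/
theorem noWildNonSurfaceWallFreeFreshJumpShallowCompanionKangarooTowers_iff_g33 (h71 : MaxContactCut.NoContactHuggingTowers) :
    NoWildNonSurfaceWallFreeFreshJumpShallowCompanionKangarooTowers ↔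
      NoWildOccultDivisorialMixedTowers ∧ NoWildOccultNonDivisorialMixedTowers :=
  noWildNonSurfaceWallFreeFreshJumpShallowCompanionKangarooTowers_iff_g32.trans
    (noWildMixedWallFreeFreshJumpShallowCompanionKangarooTowers_iff_g33_of_h71 h71)

/-- **GIVEN 31571 AND THE PORT, THE TREE ASIDE 28338 ⟺ THE g33 OCCULT CELLS** — `NoWildContactFreeOffLocusTowers` ⟺
(no wild occult
divisorial mixed tower) ∧ (no wild occult non-divisorial mixed tower). [folklore] -/
theorem noWildContactFreeOffLocusTowers_iff_g33 (h71 : MaxContactCut.NoContactHuggingTowers) (h640 : SurfaceChainPort) :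
    NoWildContactFreeOffLocusTowers ↔ NoWildOccultDivisorialMixedTowers ∧ NoWildOccultNonDivisorialMixedTowers :=
  (noWildContactFreeOffLocusTowers_iff_g32 h71 h640).trans (noWildMixedWallFreeFreshJumpShallowCompanionKangarooTowers_iff_g33_of_h71 h71)

/-- **GIVEN 31571 AND THE PORT: g23's `p`-power residual ⟺ the occult cells.** [folklore] -/
theorem noWildPPowerOffLocusTowers_iff_g33 (h71 : MaxContactCut.NoContactHuggingTowers) (h640 : SurfaceChainPort) :
    NoWildPPowerOffLocusTowers ↔ NoWildOccultDivisorialMixedTowers ∧ NoWildOccultNonDivisorialMixedTowers :=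
  (noWildPPowerOffLocusTowers_iff_g32 h71 h640).trans (noWildMixedWallFreeFreshJumpShallowCompanionKangarooTowers_iff_g33_of_h71 h71)

end FactorCells

end Summit.ResolutionOfSingularities.ResolutionOfSingularities.Theorems.HugValuationCut
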